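import Summits.QuantumFields.YangMills.Theses.ParabolicTrajectory

/-!
# `ContinuumLimitOnTrajectory` — negative-side support VII: interleaving of schemes (the universality
# content of the `∀`-over-sequences quantifier)

Support file for crux `stmt-QuantumFields-10522` ((A) of `ParabolicTrajectory`), extracted from §5 of the
standing disprover's work file `Cruxes/ContinuumLimitOnTrajectory/Disproof.lean` (cdisprove gen 3). Tree objects
only (`SpeciesScheme`, `latticeConnectedCorr`, `HasLatticeMassGap`, `IsYangMillsFor`).

* `interleaveFun`, `apply_interleaveFun`, `apply₃_interleaveFun`, `tendsto_interleaveFun`,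
  `eventually_interleaveFun`, `tendsto_two_mul_atTop`, `tendsto_two_mul_add_one_atTop`.
* `interleave` (even steps from `s₁`, odd from `s₂`) and `reindex` of `SpeciesScheme`s; `Nval`,
  `tendsto_Nval_interleave`, `interleave_shape`, `tendsto_N_interleave`, `hasLatticeMassGap_interleave`:
  every clause of the hypothesis block of (A) survives interleaving two schemes with the same `(G, r, M, θ, Δ)`
  and equal towers `(lim N_t)_t`.
* `isYangMillsFor_reindex`, `reindex_interleave_even/odd`, `witness_split_of_interleave`: a witness
  (renormalisation + OS datum) for the interleaved scheme serves both halves with the SAME OS datum.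
-/

namespace Summit.QuantumFields.YangMills.Theorems.ContinuumLimitOnTrajectory.Negative

open MeasureTheory Filter Topology
open scoped SchwartzMap
open Literature.MathematicalPhysics.QuantumFieldTheory Literature.MathematicalPhysics.QuantumLattice

noncomputable section


section InterleaveFun

variable {α : Type*}

/-- Interleaving of two sequences: even indices from `f`, odd indices from `g`. [folklore] -/
def interleaveFun (f g : ℕ → α) (k : ℕ) : α := if Even k then f (k / 2) else g (k / 2)

/-- Auxiliary. [folklore] -/
@[simp] theorem interleaveFun_two_mul (f g : ℕ → α) (j : ℕ) : interleaveFun f g (2 * j) = f j := by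
  simp [interleaveFun]

/-- Auxiliary. [folklore] -/
@[simp] theorem interleaveFun_two_mul_add_one (f g : ℕ → α) (j : ℕ) :
    interleaveFun f g (2 * j + 1) = g j := by
  have h1 : ¬ Even (2 * j + 1) := Nat.not_even_iff_odd.2 (odd_two_mul_add_one j)
  have h2 : (2 * j + 1) / 2 = j := by omega
  simp [interleaveFun, h1, h2]

/-- Interleaving commutes with pointwise operations (one sequence of data). [folklore] -/
theorem apply_interleaveFun {β : Type*} (Q : α → β) (f g : ℕ → α) (k : ℕ) :
    Q (interleaveFun f g k) = interleaveFun (fun j => Q (f j)) (fun j => Q (g j)) k := by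
  unfold interleaveFun; split_ifs <;> rfl

/-- Interleaving commutes with pointwise operations (three sequences of data). [folklore] -/
theorem apply₃_interleaveFun {β γ δ : Type*} (Q : α → β → γ → δ) (f₁ g₁ : ℕ → α) (f₂ g₂ : ℕ → β)
    (f₃ g₃ : ℕ → γ) (k : ℕ) :
    Q (interleaveFun f₁ g₁ k) (interleaveFun f₂ g₂ k) (interleaveFun f₃ g₃ k) =
      interleaveFun (fun j => Q (f₁ j) (f₂ j) (f₃ j)) (fun j => Q (g₁ j) (g₂ j) (g₃ j)) k := by
  unfold interleaveFun; split_ifs <;> rfl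

/-- **Limits survive interleaving** (any target filter). [folklore] -/
theorem tendsto_interleaveFun {l : Filter α} {f g : ℕ → α} (hf : Tendsto f atTop l)
    (hg : Tendsto g atTop l) : Tendsto (interleaveFun f g) atTop l := by
  rw [Filter.tendsto_def] at hf hg ⊢
  intro s hs
  obtain ⟨N₁, h₁⟩ := mem_atTop_sets.1 (hf s hs)
  obtain ⟨N₂, h₂⟩ := mem_atTop_sets.1 (hg s hs)
  refine mem_atTop_sets.2 ⟨2 * (N₁ + N₂), fun k hk => ?_⟩
  simp only [Set.mem_preimage, interleaveFun]
  split_ifs with he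
  · exact h₁ _ (by omega)
  · exact h₂ _ (by omega)

/-- **Eventual properties survive interleaving.** [folklore] -/
theorem eventually_interleaveFun {p : α → Prop} {f g : ℕ → α} (hf : ∀ᶠ j in atTop, p (f j))
    (hg : ∀ᶠ j in atTop, p (g j)) : ∀ᶠ k in atTop, p (interleaveFun f g k) :=
  tendsto_principal.1
    (tendsto_interleaveFun (l := 𝓟 {x | p x}) (tendsto_principal.2 hf) (tendsto_principal.2 hg))

/-- Even subsequence. [folklore] -/
theorem tendsto_two_mul_atTop : Tendsto (fun j : ℕ => 2 * j) atTop atTop :=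
  tendsto_atTop_mono (fun j : ℕ => show j ≤ 2 * j by omega) tendsto_id

/-- Odd subsequence. [folklore] -/
theorem tendsto_two_mul_add_one_atTop : Tendsto (fun j : ℕ => 2 * j + 1) atTop atTop :=
  tendsto_atTop_mono (fun j : ℕ => show j ≤ 2 * j + 1 by omega) tendsto_id

end InterleaveFun

section Schemes

variable {ι : Type}

/-- **Interleaving of two scaling schemes** (even steps from `s₁`, odd steps from `s₂`): again a
scheme (`a_k → 0` and `a_k L_k → ∞` survive interleaving). [folklore] -/
def interleave (s₁ s₂ : SpeciesScheme ι) : SpeciesScheme ι where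
  a := interleaveFun s₁.a s₂.a
  a_pos _ := by unfold interleaveFun; split_ifs <;> exact SpeciesScheme.a_pos _ _
  tendsto_a := tendsto_interleaveFun s₁.tendsto_a s₂.tendsto_a
  β := interleaveFun s₁.β s₂.β
  L := interleaveFun s₁.L s₂.L
  tendsto_L := by
    have h : (fun k => interleaveFun s₁.a s₂.a k * ((interleaveFun s₁.L s₂.L k : ℕ) : ℝ)) =
        interleaveFun (fun k => s₁.a k * s₁.L k) (fun k => s₂.a k * s₂.L k) := by
      funext k; unfold interleaveFun; split_ifs <;> rfl
    rw [h]
    exact tendsto_interleaveFun s₁.tendsto_L s₂.tendsto_L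
  c s := interleaveFun (s₁.c s) (s₂.c s)
  m s := interleaveFun (s₁.m s) (s₂.m s)

/-- **Reindexing a scheme along `φ → ∞`** (e.g. the even or odd steps). [folklore] -/
def reindex (sch : SpeciesScheme ι) (φ : ℕ → ℕ) (hφ : Tendsto φ atTop atTop) : SpeciesScheme ι where
  a k := sch.a (φ k)
  a_pos _ := sch.a_pos _
  tendsto_a := sch.tendsto_a.comp hφ
  β k := sch.β (φ k)
  L k := sch.L (φ k)
  tendsto_L := sch.tendsto_L.comp hφ
  c s k := sch.c s (φ k)
  m s k := sch.m s (φ k)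

end Schemes

section HypInterleave

variable {G : Type} [Group G] [TopologicalSpace G] [IsTopologicalGroup G] [CompactSpace G]
  [MeasurableSpace G] [BorelSpace G]

/-- The rescaled curvature correlator as a function of plain data `(β, L, m)` (torus of side
`2L+1`, separation `sep`). [folklore] -/
def Nval (r : LatticeRep G) (M : ℕ) (β : ℝ) (L m sep : ℕ) : ℝ :=
  ((M : ℝ) ^ m) ^ 8 * latticeConnectedCorr r.ρ β (2 * L + 1) r.curvature.F r.curvature.F sep

/-- **Two equal towers interleave** (plain data). [folklore] -/
theorem tendsto_Nval_interleave (r : LatticeRep G) (M : ℕ) {β₁ β₂ : ℕ → ℝ} {L₁ L₂ n₁ n₂ : ℕ → ℕ}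
    (sep : ℕ → ℕ) {c : ℝ}
    (h₁ : Tendsto (fun j => Nval r M (β₁ j) (L₁ j) (n₁ j) (sep (n₁ j))) atTop (𝓝 c))
    (h₂ : Tendsto (fun j => Nval r M (β₂ j) (L₂ j) (n₂ j) (sep (n₂ j))) atTop (𝓝 c)) :
    Tendsto (fun k => Nval r M (interleaveFun β₁ β₂ k) (interleaveFun L₁ L₂ k)
      (interleaveFun n₁ n₂ k) (sep (interleaveFun n₁ n₂ k))) atTop (𝓝 c) := by
  have h := tendsto_interleaveFun h₁ h₂
  refine h.congr (fun k => ?_)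
  rw [← apply₃_interleaveFun (fun b l m => Nval r M b l m (sep m))]

omit [TopologicalSpace G] [IsTopologicalGroup G] [CompactSpace G] [BorelSpace G] in
/-- **Shape clause of the interleaved scheme.** [folklore] -/
theorem interleave_shape {M : ℕ} {s₁ s₂ : SpeciesScheme (YMSpecies G)} {n₁ n₂ : ℕ → ℕ}
    (h₁ : ∀ k, s₁.a k = ((M : ℝ) ^ n₁ k)⁻¹) (h₂ : ∀ k, s₂.a k = ((M : ℝ) ^ n₂ k)⁻¹) (k : ℕ) :
    (interleave s₁ s₂).a k = ((M : ℝ) ^ interleaveFun n₁ n₂ k)⁻¹ := by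
  show interleaveFun s₁.a s₂.a k = _
  rw [apply_interleaveFun (fun m : ℕ => ((M : ℝ) ^ m)⁻¹) n₁ n₂ k]
  unfold interleaveFun; split_ifs <;> simp [h₁, h₂]

/-- **Equal towers of rescaled correlators interleave** (scheme form, any separation rule
`sep`, e.g. `sep m = t M^m`). [folklore] -/
theorem tendsto_N_interleave (r : LatticeRep G) (M : ℕ) {s₁ s₂ : SpeciesScheme (YMSpecies G)}
    {n₁ n₂ : ℕ → ℕ} (sep : ℕ → ℕ) {c : ℝ}
    (h₁ : Tendsto (fun j => ((M : ℝ) ^ n₁ j) ^ 8 *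
      latticeConnectedCorr r.ρ (s₁.β j) (s₁.side j) r.curvature.F r.curvature.F (sep (n₁ j)))
        atTop (𝓝 c))
    (h₂ : Tendsto (fun j => ((M : ℝ) ^ n₂ j) ^ 8 *
      latticeConnectedCorr r.ρ (s₂.β j) (s₂.side j) r.curvature.F r.curvature.F (sep (n₂ j)))
        atTop (𝓝 c)) :
    Tendsto (fun k => ((M : ℝ) ^ interleaveFun n₁ n₂ k) ^ 8 *
      latticeConnectedCorr r.ρ ((interleave s₁ s₂).β k) ((interleave s₁ s₂).side k)
        r.curvature.F r.curvature.F (sep (interleaveFun n₁ n₂ k))) atTop (𝓝 c) := by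
  have h₁' : Tendsto (fun j => Nval r M (s₁.β j) (s₁.L j) (n₁ j) (sep (n₁ j))) atTop (𝓝 c) := h₁
  have h₂' : Tendsto (fun j => Nval r M (s₂.β j) (s₂.L j) (n₂ j) (sep (n₂ j))) atTop (𝓝 c) := h₂
  exact tendsto_Nval_interleave r M sep h₁' h₂'

/-- **The uniform lattice gap survives interleaving** (constant `max C₁ C₂`). [folklore] -/
theorem hasLatticeMassGap_interleave (r : LatticeRep G) {s₁ s₂ : SpeciesScheme (YMSpecies G)}
    {Δ : ℝ} (h₁ : HasLatticeMassGap r s₁ Δ) (h₂ : HasLatticeMassGap r s₂ Δ) :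
    HasLatticeMassGap r (interleave s₁ s₂) Δ := by
  intro A B
  obtain ⟨C₁, hC₁⟩ := h₁ A B
  obtain ⟨C₂, hC₂⟩ := h₂ A B
  refine ⟨max C₁ C₂, ?_⟩
  have mono : ∀ {C : ℝ} {β a : ℝ} {L : ℕ}, C ≤ max C₁ C₂ →
      (∀ S : ℕ, L ≤ S → ∀ m : ℕ, m ≤ S →
        |latticeConnectedCorr r.ρ β (2 * S + 1) A.F B.F m| ≤ C * Real.exp (-(Δ * (a * m)))) →
      ∀ S : ℕ, L ≤ S → ∀ m : ℕ, m ≤ S →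
        |latticeConnectedCorr r.ρ β (2 * S + 1) A.F B.F m| ≤
          max C₁ C₂ * Real.exp (-(Δ * (a * m))) :=
    fun hC h S hS m hm => (h S hS m hm).trans
      (mul_le_mul_of_nonneg_right hC (Real.exp_pos _).le)
  set P : ℝ × ℝ × ℕ → Prop := fun p => ∀ S : ℕ, p.2.2 ≤ S → ∀ m : ℕ, m ≤ S →
      |latticeConnectedCorr r.ρ p.1 (2 * S + 1) A.F B.F m| ≤
        max C₁ C₂ * Real.exp (-(Δ * (p.2.1 * m))) with hP
  set d₁ : ℕ → ℝ × ℝ × ℕ := fun j => (s₁.β j, s₁.a j, s₁.L j) with hd₁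
  set d₂ : ℕ → ℝ × ℝ × ℕ := fun j => (s₂.β j, s₂.a j, s₂.L j) with hd₂
  have e₁ : ∀ᶠ j in atTop, P (d₁ j) := by
    filter_upwards [hC₁] with j hj
    exact mono (le_max_left _ _) hj
  have e₂ : ∀ᶠ j in atTop, P (d₂ j) := by
    filter_upwards [hC₂] with j hj
    exact mono (le_max_right _ _) hj
  have e := eventually_interleaveFun e₁ e₂
  filter_upwards [e] with k hk
  have hdata : interleaveFun d₁ d₂ k =
      ((interleave s₁ s₂).β k, (interleave s₁ s₂).a k, (interleave s₁ s₂).L k) := by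
    show interleaveFun d₁ d₂ k =
      (interleaveFun s₁.β s₂.β k, interleaveFun s₁.a s₂.a k, interleaveFun s₁.L s₂.L k)
    simp only [hd₁, hd₂, interleaveFun]; split_ifs <;> rfl
  rw [hdata] at hk
  exact hk

/-- **Restriction of a witness to a subsequence of steps.** [folklore] -/
theorem isYangMillsFor_reindex (r : LatticeRep G) {sch : SpeciesScheme (YMSpecies G)}
    {T : OSData (YMSpecies G) 4} (hT : IsYangMillsFor r sch T) (φ : ℕ → ℕ)
    (hφ : Tendsto φ atTop atTop) : IsYangMillsFor r (reindex sch φ hφ) T :=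
  fun n hn σ f F hF hoff => (hT n hn σ f F hF hoff).comp hφ

omit [TopologicalSpace G] [IsTopologicalGroup G] [CompactSpace G] [BorelSpace G] in
/-- Bare data of the even steps of a renormalisation of an interleaved scheme. [folklore] -/
theorem reindex_interleave_even (s₁ s₂ sch' : SpeciesScheme (YMSpecies G))
    (ha : sch'.a = (interleave s₁ s₂).a) (hβ : sch'.β = (interleave s₁ s₂).β)
    (hL : sch'.L = (interleave s₁ s₂).L) :
    (reindex sch' (fun j => 2 * j) tendsto_two_mul_atTop).a = s₁.a ∧
    (reindex sch' (fun j => 2 * j) tendsto_two_mul_atTop).β = s₁.β ∧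
    (reindex sch' (fun j => 2 * j) tendsto_two_mul_atTop).L = s₁.L := by
  refine ⟨funext fun j => ?_, funext fun j => ?_, funext fun j => ?_⟩
  · show sch'.a (2 * j) = _; rw [ha]; exact interleaveFun_two_mul _ _ _
  · show sch'.β (2 * j) = _; rw [hβ]; exact interleaveFun_two_mul _ _ _
  · show sch'.L (2 * j) = _; rw [hL]; exact interleaveFun_two_mul _ _ _

omit [TopologicalSpace G] [IsTopologicalGroup G] [CompactSpace G] [BorelSpace G] in
/-- Bare data of the odd steps of a renormalisation of an interleaved scheme. [folklore] -/
theorem reindex_interleave_odd (s₁ s₂ sch' : SpeciesScheme (YMSpecies G))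
    (ha : sch'.a = (interleave s₁ s₂).a) (hβ : sch'.β = (interleave s₁ s₂).β)
    (hL : sch'.L = (interleave s₁ s₂).L) :
    (reindex sch' (fun j => 2 * j + 1) tendsto_two_mul_add_one_atTop).a = s₂.a ∧
    (reindex sch' (fun j => 2 * j + 1) tendsto_two_mul_add_one_atTop).β = s₂.β ∧
    (reindex sch' (fun j => 2 * j + 1) tendsto_two_mul_add_one_atTop).L = s₂.L := by
  refine ⟨funext fun j => ?_, funext fun j => ?_, funext fun j => ?_⟩
  · show sch'.a (2 * j + 1) = _; rw [ha]; exact interleaveFun_two_mul_add_one _ _ _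
  · show sch'.β (2 * j + 1) = _; rw [hβ]; exact interleaveFun_two_mul_add_one _ _ _
  · show sch'.L (2 * j + 1) = _; rw [hL]; exact interleaveFun_two_mul_add_one _ _ _

/-- **A witness for the interleaved scheme serves both halves — with the SAME OS datum.** [folklore] -/
theorem witness_split_of_interleave (r : LatticeRep G) {s₁ s₂ : SpeciesScheme (YMSpecies G)}
    (h : ∃ sch' : SpeciesScheme (YMSpecies G), sch'.a = (interleave s₁ s₂).a ∧
      sch'.β = (interleave s₁ s₂).β ∧ sch'.L = (interleave s₁ s₂).L ∧
      ∃ T : OSData (YMSpecies G) 4,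
        IsYangMillsFor r sch' T ∧ T.IsNontrivial r.curvature ∧ T.IsNonGaussian r.curvature) :
    ∃ T : OSData (YMSpecies G) 4,
      (∃ t₁ : SpeciesScheme (YMSpecies G), t₁.a = s₁.a ∧ t₁.β = s₁.β ∧ t₁.L = s₁.L ∧
        IsYangMillsFor r t₁ T) ∧
      (∃ t₂ : SpeciesScheme (YMSpecies G), t₂.a = s₂.a ∧ t₂.β = s₂.β ∧ t₂.L = s₂.L ∧
        IsYangMillsFor r t₂ T) ∧
      T.IsNontrivial r.curvature ∧ T.IsNonGaussian r.curvature := by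
  obtain ⟨sch', ha, hβ, hL, T, hYM, hNT, hNG⟩ := h
  obtain ⟨ea, eβ, eL⟩ := reindex_interleave_even s₁ s₂ sch' ha hβ hL
  obtain ⟨oa, oβ, oL⟩ := reindex_interleave_odd s₁ s₂ sch' ha hβ hL
  exact ⟨T, ⟨_, ea, eβ, eL, isYangMillsFor_reindex r hYM _ tendsto_two_mul_atTop⟩,
    ⟨_, oa, oβ, oL, isYangMillsFor_reindex r hYM _ tendsto_two_mul_add_one_atTop⟩, hNT, hNG⟩

end HypInterleave


end

end Summit.QuantumFields.YangMills.Theorems.ContinuumLimitOnTrajectory.Negative
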